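import Literature.AnabelianGeometry.SemiGraphs.TemperoidsHomFibre
import Literature.AnabelianGeometry.SemiGraphs.QuasiTemperoidsPiProofs
import Literature.AnabelianGeometry.SemiGraphs.BTempLimitsProofs
import Literature.AnabelianGeometry.SemiGraphs.QuasiTemperoidsThmA4ChartDefs
import Mathlib.CategoryTheory.Limits.FullSubcategory
import HarnessLib

/-!
# Semi-graphs of anabelioids, Appendix: Theorem A.4 (chart route) — the fibre functor of a morphism
# of connected quasi-temperoids `T₁[A₁] → T₂[A₂]`

Mochizuki, *Semi-graphs of anabelioids*, Publ. RIMS **42** (2006), Appendix, Theorem A.4 (manuscript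
pp. 82–86) [cite: MochizukiSemiAnbd2006, Thm A.4 pp.82-86].  PROOF-ONLY port (no definitions) of the
tree's `TemperoidsHomFibre.lean` (abc-iut-L3-d2; [SemiAnbd] Prop. 3.2 engine) from functors
`B^temp(Π₂) ⥤ B^temp(Π₁)` to functors `F : T₂[A₂] ⥤ T₁[A₁]` between the full subcategories `T[A] = Over' A`
preserving finite limits and countable colimits (Def. A.1 (iii) / 3.1 (iii)) and NONDEGENERATE objects:
what `F` does, on underlying sets, to empty objects (`map_isEmpty`), NONEMPTY objects (`map_nonempty` —
the replacement, through `PreservesNondegenerate`, of the terminal-object step of Prop. 3.2, which is not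
available since `T[A]` has no terminal object, Rmk. A.1.2), fixed-point-free endomorphisms
(`map_fixedPointFree`) and quotients by countable groups of endomorphisms (`map_quotient`).  Finite limits
of nonempty shape and countable coproducts of `T[A]` are computed in `B^temp(Π)` (`T[A]` is closed under
them); the one colimit that is not automatic — a quotient `X/K` — lands in `T[A]` as soon as the quotient
map does, which is how `map_quotient` is phrased.  L3-lead μ3-1/ν3-1, row C-S1a (fibre half).
Nothing here takes a side on [IUTchIII] Cor. 3.12.
-/

namespace Literature.AnabelianGeometry.SemiGraphs

namespace ThmA4Chart

open CategoryTheory CategoryTheory.Limits Topology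
open Literature.AlgebraicGeometry.Frobenioids (IsConnectedObj IsNonemptyObj)

universe u

/-! ### `T[A]` inside `B^temp(Π)`: the fibre functor and the (co)limits it preserves -/

section Closure

variable {G : Type u} [Group G] [TopologicalSpace G]

omit [TopologicalSpace G] in
/-- `C[A]` is closed under limits of any NONEMPTY shape (the limit maps to `A` through any leg).
[cite: MochizukiSemiAnbd2006, §0 p.6] -/
theorem admitsHomTo_isClosedUnderLimitsOfShape {C : Type*} [Category C] (A : C) (J : Type*)
    [Category J] [Nonempty J] : (admitsHomTo A).IsClosedUnderLimitsOfShape J :=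
  ⟨fun _ hX => by
    obtain ⟨p⟩ := hX
    obtain ⟨j⟩ := ‹Nonempty J›
    exact ⟨p.π.app j ≫ (p.prop_diag_obj j).some⟩⟩

variable [IsTopologicalGroup G]

/-- The fibre functor `T[A] ⥤ B^temp(Π) ⥤ Type` preserves finite limits of nonempty shape (they are
computed in `B^temp(Π)`, hence on underlying sets). [cite: MochizukiSemiAnbd2006, Def A.1(iii) p.79] -/
theorem fibre_preservesLimitsOfShape (A : BTemp G) (J : Type) [SmallCategory J] [FinCategory J]
    [Nonempty J] :
    PreservesLimitsOfShape J
      ((admitsHomTo A).ι ⋙ (temperedAction G).ι ⋙ Action.forget (Type u) G) := by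
  haveI : HasLimitsOfShape J (BTemp G) := BTemp.hasLimitsOfShape_of_finCategory J
  haveI := admitsHomTo_isClosedUnderLimitsOfShape A J
  haveI : PreservesLimitsOfShape J (admitsHomTo A).ι := inferInstance
  haveI := BTemp.preservesLimitsOfShape_forget (G := G) J
  infer_instance

omit [IsTopologicalGroup G] in
/-- The fibre functor `T[A] ⥤ B^temp(Π) ⥤ Type` reflects limits. [cite: MochizukiSemiAnbd2006, Def A.1(iii) p.79] -/
theorem fibre_reflectsLimitsOfShape (A : BTemp G) (J : Type) [SmallCategory J] :
    ReflectsLimitsOfShape J ((admitsHomTo A).ι ⋙ (temperedAction G).ι ⋙ Action.forget (Type u) G) := by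
  haveI := BTemp.fibre_reflectsLimitsOfShape G J
  infer_instance

omit [IsTopologicalGroup G] in
/-- The fibre functor `T[A] ⥤ B^temp(Π) ⥤ Type` reflects colimits. [cite: MochizukiSemiAnbd2006, Def A.1(iii) p.79] -/
theorem fibre_reflectsColimitsOfShape (A : BTemp G) (J : Type) [SmallCategory J] :
    ReflectsColimitsOfShape J
      ((admitsHomTo A).ι ⋙ (temperedAction G).ι ⋙ Action.forget (Type u) G) := by
  haveI := BTemp.fibre_reflectsColimitsOfShape G J
  infer_instance

end Closure

/-! ### The engine's data -/

variable {G₁ : Type u} [Group G₁] [TopologicalSpace G₁] [IsTopologicalGroup G₁]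
  {G₂ : Type u} [Group G₂] [TopologicalSpace G₂] [IsTopologicalGroup G₂] (hG₂ : IsTempered G₂)
  {A₁ : BTemp G₁} (hA₁ : IsConnectedObj A₁) {A₂ : BTemp G₂} (a₂ : A₂.obj.V)
  (F : Over' A₂ ⥤ Over' A₁) (hlim : PreservesFiniteLimits F)
  (hcolim : ∀ (J : Type) [SmallCategory J] [CountableCategory J], PreservesColimitsOfShape J F)
  (hnd : ∀ X : Over' A₂, IsNondegenerateObj X → IsNondegenerateObj (F.obj X))

/-! ### Empty and nonempty objects -/

include hcolim in
omit [IsTopologicalGroup G₁] [IsTopologicalGroup G₂] in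
/-- `F` maps empty objects to empty objects (they are initial in `T[A]`, and `F` preserves the empty
colimit). [cite: MochizukiSemiAnbd2006, Thm A.4 pp.82-86] -/
theorem map_isEmpty (X : Over' A₂) [h : IsEmpty X.obj.obj.V] : IsEmpty (F.obj X).obj.obj.V := by
  obtain ⟨hX⟩ := overPrime_isInitial_of_isEmpty X h
  haveI : PreservesColimitsOfShape (Discrete PEmpty.{1}) F := hcolim _
  exact overPrime_isEmpty_of_isInitial (IsInitial.isInitialObj F X hX)

include hG₂ hA₁ hnd in
omit [IsTopologicalGroup G₁] in
/-- `F` maps NONEMPTY objects to nonempty objects: a nonempty object of `T₂[A₂]` is nondegenerate (any two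
objects with points are dominated by a common connected object), `F` preserves nondegenerate objects,
and a nondegenerate object of `T₁[A₁]` receives an arrow from a connected — in particular nonempty —
object (test it against `A₁` over itself). This replaces the terminal-object step of Prop. 3.2.
[cite: MochizukiSemiAnbd2006, Thm A.4 pp.82-86] -/
theorem map_nonempty (X : Over' A₂) (hX : Nonempty X.obj.obj.V) : Nonempty (F.obj X).obj.obj.V := by
  have hXnd : IsNondegenerateObj X := by
    intro B hB
    obtain ⟨b⟩ := overPrime_nonempty_of_isNonemptyObj hB.1
    obtain ⟨x⟩ := hX
    exact overPrime_exists_isConnectedObj_hom_hom hG₂ B X b x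
  obtain ⟨C, hC, -, ⟨k⟩⟩ := hnd X hXnd (base A₁) (overPrime_isConnectedObj_self hA₁)
  obtain ⟨c⟩ := overPrime_nonempty_of_isNonemptyObj hC.1
  exact ⟨k.hom.hom.hom c⟩

/-! ### Fixed-point-free endomorphisms -/

include hlim hcolim in
/-- `F` maps fixed-point-free endomorphisms to fixed-point-free endomorphisms (the equalizer with the
identity is empty; equalizers of `T₂[A₂]` are computed in `B^temp(Π₂)`, and `F` preserves them and the
empty object). [cite: MochizukiSemiAnbd2006, Thm A.4 pp.82-86] -/
theorem map_fixedPointFree {X : Over' A₂} (f : X ⟶ X) (hf : ∀ x : X.obj.obj.V, f.hom.hom.hom x ≠ x)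
    (y : (F.obj X).obj.obj.V) : (F.map f).hom.hom.hom y ≠ y := by
  intro hy
  let Φ₁ := (admitsHomTo A₁).ι ⋙ (temperedAction G₁).ι ⋙ Action.forget (Type u) G₁
  haveI : HasLimitsOfShape WalkingParallelPair (BTemp G₂) :=
    BTemp.hasLimitsOfShape_of_finCategory WalkingParallelPair
  haveI := admitsHomTo_isClosedUnderLimitsOfShape A₂ WalkingParallelPair
  haveI : HasLimitsOfShape WalkingParallelPair (Over' A₂) := inferInstance
  -- the equalizer of `f` and the identity is empty
  let E : Over' A₂ := equalizer f (𝟙 X)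
  haveI : IsEmpty E.obj.obj.V := ⟨fun x₀ => by
    have h := congrArg (fun k : E ⟶ X => k.hom.hom.hom x₀) (equalizer.condition f (𝟙 X))
    exact hf _ h⟩
  have hE : IsEmpty (F.obj E).obj.obj.V := map_isEmpty F hcolim E
  -- `F ⋙ fibre` preserves the equalizer
  haveI : PreservesLimitsOfShape WalkingParallelPair F := hlim.preservesFiniteLimits _
  haveI := fibre_preservesLimitsOfShape A₁ WalkingParallelPair
  have l := isLimitOfHasEqualizerOfPreservesLimit (F ⋙ Φ₁) f (𝟙 X)
  have hk : (TypeCat.ofHom fun _ : PUnit.{u + 1} => y) ≫ (F ⋙ Φ₁).map f =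
      (TypeCat.ofHom fun _ : PUnit.{u + 1} => y) ≫ (F ⋙ Φ₁).map (𝟙 X) := by
    rw [CategoryTheory.Functor.map_id]
    refine ConcreteCategory.hom_ext _ _ fun x => ?_
    simp only [types_comp_apply, TypeCat.ofHom_apply]
    exact hy
  obtain ⟨k, -⟩ := Fork.IsLimit.lift' l _ hk
  exact hE.false (k PUnit.unit)

/-! ### Quotients by a countable group of endomorphisms -/

include hcolim in
omit [IsTopologicalGroup G₂] in
/-- `F` maps quotients to quotients: if a countable group `K` acts on `X ∈ T₂[A₂]` by endomorphisms `a k`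
and `π : X ⟶ W` (in `T₂[A₂]`) is surjective with fibres the `K`-orbits — so that `W = X/K` is the colimit,
in `B^temp(Π₂)` and hence in `T₂[A₂]`, of the action diagram — then `F π` is surjective with fibres the
`K`-orbits for the `F (a k)` (the colimit `F(X)/K` of `B^temp(Π₁)` maps to `A₁` through `F(W)`, so it is
the colimit in `T₁[A₁]` too, and is computed on underlying sets). [cite: MochizukiSemiAnbd2006, Thm A.4 pp.82-86] -/
theorem map_quotient {K : Type} [Group K] [Countable K] {X W : Over' A₂}
    (a : K →* End X) (π : X ⟶ W) (hπ : ∀ k, a k ≫ π = π)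
    (hsurj : ∀ w : W.obj.obj.V, ∃ x : X.obj.obj.V, π.hom.hom.hom x = w)
    (hfib : ∀ x x' : X.obj.obj.V, π.hom.hom.hom x = π.hom.hom.hom x' → ∃ k, (a k).hom.hom.hom x = x') :
    (∀ z : (F.obj W).obj.obj.V, ∃ y : (F.obj X).obj.obj.V, (F.map π).hom.hom.hom y = z) ∧
      ∀ y y' : (F.obj X).obj.obj.V, (F.map π).hom.hom.hom y = (F.map π).hom.hom.hom y' ↔
        ∃ k, (F.map (a k)).hom.hom.hom y = y' := by
  classical
  let Φ₂ := (admitsHomTo A₂).ι ⋙ (temperedAction G₂).ι ⋙ Action.forget (Type u) G₂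
  let ΦB := (temperedAction G₁).ι ⋙ Action.forget (Type u) G₁
  let Φ₁ := (admitsHomTo A₁).ι ⋙ ΦB
  haveI : CountableCategory (SingleObj K) :=
    { countableObj := by unfold SingleObj Quiver.SingleObj; infer_instance
      countableHom := fun _ _ => (inferInstance : Countable K) }
  haveI : Countable (SingleObj K) := by unfold SingleObj Quiver.SingleObj; infer_instance
  -- the action diagram and the quotient cocone
  let D : SingleObj K ⥤ Over' A₂ := SingleObj.functor a
  let c : Cocone D :=
    { pt := W
      ι := { app := fun _ => π
             naturality := fun _ _ k => by
               show a k ≫ π = π ≫ 𝟙 W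
               rw [Category.comp_id]
               exact hπ k } }
  -- it is a colimit: check on underlying sets
  haveI := fibre_reflectsColimitsOfShape A₂ (SingleObj K)
  have hc0 : ((D ⋙ Φ₂).coconeTypesEquiv.symm (Φ₂.mapCocone c)).IsColimit := by
    refine ⟨⟨?_, ?_⟩⟩
    · intro p q h
      induction p using Quot.ind with | _ p =>
      induction q using Quot.ind with | _ q =>
      obtain ⟨j, x⟩ := p
      obtain ⟨j', x'⟩ := q
      obtain rfl : j = j' := Subsingleton.elim _ _
      change π.hom.hom.hom x = π.hom.hom.hom x' at h
      obtain ⟨k, hk⟩ := hfib x x' h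
      exact Quot.sound ⟨k, hk.symm⟩
    · rw [Functor.CoconeTypes.descColimitType_surjective_iff]
      intro z
      obtain ⟨x, hx⟩ := hsurj z
      exact ⟨SingleObj.star K, x, hx⟩
  have hc : IsColimit c :=
    isColimitOfReflects Φ₂ ((Types.isColimit_iff_coconeTypesIsColimit _).mpr hc0).some
  -- `F` preserves it; its image under the inclusion into `B^temp(Π₁)` is still a colimit, because the
  -- colimit of `B^temp(Π₁)` maps to `A₁` through `F(W)`
  haveI : PreservesColimitsOfShape (SingleObj K) F := hcolim _
  have hcF : IsColimit (F.mapCocone c) := isColimitOfPreserves F hc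
  haveI : HasColimitsOfShape (SingleObj K) (BTemp G₁) := BTemp.hasColimitsOfShape_of_countable _
  haveI : CreatesColimit (D ⋙ F) (admitsHomTo A₁).ι :=
    createsColimitFullSubcategoryInclusion' (D ⋙ F) (colimit.isColimit _)
      ⟨colimit.desc ((D ⋙ F) ⋙ (admitsHomTo A₁).ι) ((admitsHomTo A₁).ι.mapCocone (F.mapCocone c)) ≫
        (F.obj W).property.some⟩
  haveI := BTemp.fibre_preservesColimitsOfShape G₁ (SingleObj K)
  have hFc1 : IsColimit ((F ⋙ Φ₁).mapCocone c) :=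
    isColimitOfPreserves ΦB (isColimitOfPreserves (admitsHomTo A₁).ι hcF)
  have hFc := (Types.isColimit_iff_coconeTypesIsColimit ((F ⋙ Φ₁).mapCocone c)).mp ⟨hFc1⟩
  -- bookkeeping for the endomorphisms `F (a k)`
  have hF1 : ∀ y : (F.obj X).obj.obj.V, (F.map (a 1)).hom.hom.hom y = y := by
    intro y
    rw [map_one, show (1 : End X) = 𝟙 X from rfl, F.map_id]
    rfl
  have hFmul : ∀ (k k' : K) (y : (F.obj X).obj.obj.V),
      (F.map (a (k * k'))).hom.hom.hom y = (F.map (a k)).hom.hom.hom ((F.map (a k')).hom.hom.hom y) := by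
    intro k k' y
    rw [map_mul, End.mul_def, F.map_comp]
    rfl
  refine ⟨fun z => ?_, fun y y' => ⟨fun h => ?_, ?_⟩⟩
  · obtain ⟨_, y, hy⟩ := hFc.ι_jointly_surjective z
    exact ⟨y, hy⟩
  · have h1 : (D ⋙ F ⋙ Φ₁).ιColimitType (SingleObj.star K) y =
        (D ⋙ F ⋙ Φ₁).ιColimitType (SingleObj.star K) y' := by
      rw [← hFc.equiv_symm_ι_apply, ← hFc.equiv_symm_ι_apply]
      exact congrArg _ h
    rw [Functor.ιColimitType_eq_iff] at h1
    have key : ∀ p p' : Σ j : SingleObj K, (D ⋙ F ⋙ Φ₁).obj j,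
        Relation.EqvGen (D ⋙ F ⋙ Φ₁).ColimitTypeRel p p' →
        ∃ k : K, (F.map (a k)).hom.hom.hom p.2 = p'.2 := by
      intro p p' hpp
      induction hpp with
      | rel p p' hr =>
        obtain ⟨f, hf⟩ := hr
        exact ⟨f, hf.symm⟩
      | refl p => exact ⟨1, hF1 _⟩
      | symm p p' _ ih =>
        obtain ⟨k, hk⟩ := ih
        refine ⟨k⁻¹, ?_⟩
        rw [← hk, ← hFmul, inv_mul_cancel, hF1]
      | trans p p' p'' _ _ ih ih' =>
        obtain ⟨k, hk⟩ := ih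
        obtain ⟨k', hk'⟩ := ih'
        exact ⟨k' * k, by rw [hFmul, hk, hk']⟩
    exact key _ _ h1
  · rintro ⟨k, rfl⟩
    change (F.map π).hom.hom.hom y = (F.map (a k) ≫ F.map π).hom.hom.hom y
    rw [← F.map_comp, hπ k]

end ThmA4Chart

end Literature.AnabelianGeometry.SemiGraphs
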